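import Literature.NumberTheory.Automorphic.ArchimedeanExpChart
import Literature.NumberTheory.Automorphic.AutomorphicRepsGLCuspidalSpectralSupportProofs
import Literature.NumberTheory.Automorphic.ImaginaryQuadraticArchimedeanGL
import HarnessLib

/-!
# Smoothness in the archimedean variable is Fréchet smoothness on `GL_n(K_∞) ⊆ M_n(K_∞)`
# (and on `GL_n(ℂ) ⊆ M_n(ℂ)` for an imaginary quadratic field)

Topic `NumberTheory/Automorphic`; namespace `Literature.NumberTheory.Automorphic`. Theorems only
(no definition, no named fact, no `sorry`).

The tree's smoothness notion for a function `φ : GL_n(𝔸_K) → ℂ` is `IsArchSmooth` (Borel–Jacquet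
1979, §1.1, §4.1): for every `g`, `X ↦ φ (g · (exp X, 1))` is `C^∞` on `𝔤 = M_n(K_∞)` (exponential
coordinates at each point).  Calculus on the archimedean group done in the AMBIENT MATRIX SPACE —
as for the Eichler–Shimura–Harder cochains of `GL2CEquivariantPrimitive` / `GL2CVanEst`, which are
functions on `M₂(ℂ)` of class `C¹` on the open set `{det ≠ 0}` (Mathlib's Fréchet calculus with the
`L^∞`-operator norm `Matrix.Norms.Operator`) — needs the equivalent formulation:

* `contDiffOn_of_isArchSmooth` — if `φ` is smooth in the archimedean variable then, for every
  `x ∈ GL_n(𝔸_K)`, any `F : M_n(K_∞) → ℂ` with `F M = φ ((M, 1) · x)` on invertible `M` is `C^∞`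
  on the open set `{M | IsUnit (det M)}`;
* `ImaginaryQuadratic.contDiffOn_complex_of_isArchSmooth` — for `K` imaginary quadratic
  (`finrank ℚ K = 2`, `K_∞ = ℂ` through `ImaginaryQuadratic.mixedSpaceEquivComplex`), the same with
  `M_n(ℂ)` and the section `ImaginaryQuadratic.ofComplexGL : GL_n(ℂ) →* GL_n(𝔸_K)`.

Proof: near an invertible `M₀`, `M = M₀ exp (log (M₀⁻¹ M))` with `log` the local inverse of `exp`
at `0`, smooth on a neighbourhood of `1` (`exists_log_contDiffAt_nhds_one`, the inverse function
theorem); so `F = Φ ∘ log ∘ (M₀⁻¹ ·)` near `M₀` with `Φ X = φ ((M₀, 1) (exp X, 1) x)`, which is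
`C^∞` by `IsArchSmooth` applied to the right translate `φ (· x)` (`isArchSmooth_comp_mul_right_gl`).
[cite: BorelJacquetCorvallis1979, §1.1] [cite: Hall2015, Cor. 3.44]

## References

* A. Borel, H. Jacquet, *Automorphic forms and automorphic representations*, Proc. Sympos. Pure
  Math. 33 (1979), Part 1, §1.1 (smooth functions on `G_∞`), §4.1 [BorelJacquetCorvallis1979].
* B. C. Hall, *Lie Groups, Lie Algebras, and Representations*, 2nd ed. (2015), Thm. 3.42,
  Cor. 3.44 (exponential coordinates on matrix groups) [Hall2015].
-/

noncomputable section

open scoped MatrixGroups Matrix ContDiff Topology Matrix.Norms.Operator Classical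
open Filter Set NumberField NumberField.mixedEmbedding IsDedekindDomain

namespace Literature.NumberTheory.Automorphic

variable {n : ℕ} {K : Type} [Field K] [NumberField K] {hcpt : isCompact_glFiniteIntegralLevel n K}

/-! ### 1. The open set of invertible matrices over `K_∞` -/

/-- `{M ∈ M_n(K_∞) | det M invertible}` is open (the units of the complete normed ring `K_∞` are
open and `det` is continuous). [folklore] -/
theorem isOpen_setOf_isUnit_det_mixedSpace :
    IsOpen {M : Matrix (Fin n) (Fin n) (mixedSpace K) | IsUnit M.det} := by
  have hc : Continuous fun M : Matrix (Fin n) (Fin n) (mixedSpace K) => M.det :=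
    continuous_id.matrix_det
  exact Units.isOpen.preimage hc

/-! ### 2. `IsArchSmooth` ⇒ `C^∞` on `GL_n(K_∞) ⊆ M_n(K_∞)` -/

set_option backward.isDefEq.respectTransparency false in
/-- **Smoothness in the archimedean variable is Fréchet smoothness on the open set of invertible
matrices.**  Let `φ : GL_n(𝔸_K) → ℂ` be smooth in the archimedean variable (`IsArchSmooth` for the
automorphy datum of `GL_n`) and `x ∈ GL_n(𝔸_K)`.  Then every `F : M_n(K_∞) → ℂ` which agrees with
`M ↦ φ ((M, 1) · x)` on invertible matrices is `C^∞` on `{M | IsUnit (det M)}` (an open subset of the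
real normed space `M_n(K_∞)`, `L^∞`-operator norm). Borel–Jacquet 1979, §1.1; Hall 2015, Cor. 3.44.
[cite: BorelJacquetCorvallis1979, §1.1] -/
theorem contDiffOn_of_isArchSmooth {φ : (AdelicGroupData.gl n K).Adelic → ℂ}
    (hφ : IsArchSmooth (AutomorphyDatum.gl n K hcpt).ofArch φ) (x : GL (Fin n) (AdeleRing (𝓞 K) K))
    {F : Matrix (Fin n) (Fin n) (mixedSpace K) → ℂ}
    (hF : ∀ (M : Matrix (Fin n) (Fin n) (mixedSpace K)) (h : IsUnit M.det),
      F M = φ (GLn.ofInfinite n K (Matrix.GeneralLinearGroup.mk'' M h) * x)) :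
    ContDiffOn ℝ ∞ F {M : Matrix (Fin n) (Fin n) (mixedSpace K) | IsUnit M.det} := by
  -- the element `x` and the right translate `φ (· x)`, typed on the adelic group datum
  set x' : (AdelicGroupData.gl n K).Adelic := x with hx'
  have hφx : IsArchSmooth (AutomorphyDatum.gl n K hcpt).ofArch (fun z => φ (z * x')) :=
    isArchSmooth_comp_mul_right_gl hφ x'
  -- the inclusion of `M_n(K_∞)` in the (full) Lie algebra, a continuous linear map (the commutator
  -- Lie ring structure on the matrix algebra, Mathlib's `LieRing.ofAssociativeRing`, is not a
  -- global instance at this priority in the tree's idiom; install it locally for this proof)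
  letI : LieRing (Matrix (Fin n) (Fin n) (mixedSpace K)) := LieRing.ofAssociativeRing
  letI : LieAlgebra ℝ (Matrix (Fin n) (Fin n) (mixedSpace K)) := LieAlgebra.ofAssociativeAlgebra
  let jL : Matrix (Fin n) (Fin n) (mixedSpace K) →ₗ[ℝ] (archGroupGL n K).lie.toSubmodule :=
    { toFun := fun X => ⟨X, (LieSubalgebra.mem_top X : X ∈ (archGroupGL n K).lie)⟩
      map_add' := fun _ _ => rfl
      map_smul' := fun _ _ => rfl }
  have hj : ContDiff ℝ ∞ fun X : Matrix (Fin n) (Fin n) (mixedSpace K) => jL X :=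
    jL.toContinuousLinearMap.contDiff
  -- a local logarithm near `1`
  obtain ⟨log, hlog, hexplog, -⟩ :=
    exists_log_contDiffAt_nhds_one (A := mixedSpace K) (N := Fin n)
  intro M₀ hM₀
  have h₀ : IsUnit M₀.det := hM₀
  set u₀ : GL (Fin n) (mixedSpace K) := Matrix.GeneralLinearGroup.mk'' M₀ h₀ with hu₀
  have hcoe₀ : (u₀ : Matrix (Fin n) (Fin n) (mixedSpace K)) = M₀ := rfl
  -- `ψ M = M₀⁻¹ M`, smooth, `ψ M₀ = 1`
  set ψ : Matrix (Fin n) (Fin n) (mixedSpace K) → Matrix (Fin n) (Fin n) (mixedSpace K) :=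
    fun M => ((u₀⁻¹ : GL (Fin n) (mixedSpace K)) : Matrix (Fin n) (Fin n) (mixedSpace K)) * M with hψ
  have hψc : ContDiff ℝ ∞ ψ := contDiff_const.mul contDiff_id
  have hψ₀ : ψ M₀ = 1 := by
    simp only [hψ, ← hcoe₀, ← Matrix.GeneralLinearGroup.coe_mul, inv_mul_cancel,
      Matrix.GeneralLinearGroup.coe_one]
  -- `Φ X = φ ((M₀, 1) (exp X, 1) x)`, smooth by `IsArchSmooth`
  set g₀ : (AdelicGroupData.gl n K).Adelic := (GLn.ofInfinite n K u₀ : (AdelicGroupData.gl n K).Adelic)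
    with hg₀
  set Φ : Matrix (Fin n) (Fin n) (mixedSpace K) → ℂ := fun X =>
    φ (g₀ * (AutomorphyDatum.gl n K hcpt).ofArch
      ((archGroupGL n K).expMem ⟨(jL X : (archGroupGL n K).lie.toSubmodule), (jL X).2⟩) * x') with hΦ
  have hΦc : ContDiff ℝ ∞ Φ := (hφx g₀).comp hj
  -- `F = Φ ∘ log ∘ ψ` near `M₀`
  have hev : ∀ᶠ M in 𝓝 M₀, F M = Φ (log (ψ M)) := by
    have h1 : ∀ᶠ M in 𝓝 M₀, NormedSpace.exp (log (ψ M)) = ψ M :=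
      (hψc.continuous.tendsto' M₀ 1 hψ₀).eventually hexplog
    have h2 : ∀ᶠ M in 𝓝 M₀, IsUnit M.det := isOpen_setOf_isUnit_det_mixedSpace.mem_nhds hM₀
    filter_upwards [h1, h2] with M hM hMu
    rw [hF M hMu]
    -- `mk'' M = u₀ · exp (log (ψ M))` in `GL_n(K_∞)`
    have hGL : Matrix.GeneralLinearGroup.mk'' M hMu =
        u₀ * expGL (log (ψ M)) := by
      refine Matrix.GeneralLinearGroup.ext fun i j => ?_
      rw [Matrix.GeneralLinearGroup.coe_mul, coe_expGL, hM]
      change M i j = ((u₀ : Matrix (Fin n) (Fin n) (mixedSpace K)) *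
        (((u₀⁻¹ : GL (Fin n) (mixedSpace K)) : Matrix (Fin n) (Fin n) (mixedSpace K)) * M)) i j
      rw [← Matrix.mul_assoc, ← Matrix.GeneralLinearGroup.coe_mul, mul_inv_cancel,
        Matrix.GeneralLinearGroup.coe_one, Matrix.one_mul]
    rw [hGL, map_mul]
    rfl
  -- smoothness at `M₀`
  have hlog₀ : ContDiffAt ℝ ∞ log (ψ M₀) := by
    rw [hψ₀]
    exact hlog.self_of_nhds
  have hcomp : ContDiffAt ℝ ∞ (fun M => Φ (log (ψ M))) M₀ :=
    hΦc.contDiffAt.comp M₀ (hlog₀.comp M₀ hψc.contDiffAt)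
  exact (hcomp.congr_of_eventuallyEq hev).contDiffWithinAt

/-! ### 3. The case of an imaginary quadratic field: `GL_n(ℂ) ⊆ M_n(ℂ)` -/

namespace ImaginaryQuadratic

variable [IsTotallyComplex K]

omit [NumberField K] in
/-- `ofComplex` on real numbers is the real algebra map of `K_∞`. [folklore] -/
theorem ofComplex_ofReal (r : ℝ) : ofComplex K (r : ℂ) = algebraMap ℝ (mixedSpace K) r := by
  haveI : IsEmpty {w : InfinitePlace K // w.IsReal} := isEmpty_isReal K
  exact Prod.ext (Subsingleton.elim _ _) (funext fun _ => rfl)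

omit [NumberField K] in
/-- `ofComplex` is real-linear. [folklore] -/
theorem ofComplex_real_smul (r : ℝ) (z : ℂ) : ofComplex K (r • z) = r • ofComplex K z := by
  rw [Complex.real_smul, map_mul, ofComplex_ofReal, Algebra.smul_def]

omit [NumberField K] in
/-- Entrywise `ofComplex` is additive on `M_n(ℂ)`. [folklore] -/
theorem map_ofComplex_add (M N : Matrix (Fin n) (Fin n) ℂ) :
    (M + N).map (ofComplex K) = M.map (ofComplex K) + N.map (ofComplex K) :=
  Matrix.map_add (ofComplex K) (map_add (ofComplex K)) M N

omit [NumberField K] in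
/-- Entrywise `ofComplex` commutes with real scalars. [folklore] -/
theorem map_ofComplex_smul (r : ℝ) (M : Matrix (Fin n) (Fin n) ℂ) :
    (r • M).map (ofComplex K) = r • M.map (ofComplex K) :=
  Matrix.ext fun i j => by
    simp only [Matrix.map_apply, Matrix.smul_apply, ofComplex_real_smul]

/-- **`IsArchSmooth` ⇒ `C^∞` on `GL_n(ℂ) ⊆ M_n(ℂ)` for an imaginary quadratic field.**  Let
`finrank ℚ K = 2`, `φ : GL_n(𝔸_K) → ℂ` smooth in the archimedean variable and `x ∈ GL_n(𝔸_K)`.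
Every `F : M_n(ℂ) → ℂ` which agrees with `M ↦ φ (ofComplexGL M · x)` on invertible matrices is
`C^∞` on `{M | IsUnit (det M)}` (real Fréchet calculus on `M_n(ℂ)` with the `L^∞`-operator norm).
[cite: BorelJacquetCorvallis1979, §1.1] -/
theorem contDiffOn_complex_of_isArchSmooth (h2 : Module.finrank ℚ K = 2)
    {φ : (AdelicGroupData.gl n K).Adelic → ℂ}
    (hφ : IsArchSmooth (AutomorphyDatum.gl n K hcpt).ofArch φ) (x : GL (Fin n) (AdeleRing (𝓞 K) K))
    {F : Matrix (Fin n) (Fin n) ℂ → ℂ}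
    (hF : ∀ (M : Matrix (Fin n) (Fin n) ℂ) (h : IsUnit M.det),
      F M = φ (ofComplexGL K n (Matrix.GeneralLinearGroup.mk'' M h) * x)) :
    ContDiffOn ℝ ∞ F {M : Matrix (Fin n) (Fin n) ℂ | IsUnit M.det} := by
  -- the real-linear map `L M = M.map ofComplex` and `G M' = F (M'.map toComplex)`
  let Lₗ : Matrix (Fin n) (Fin n) ℂ →ₗ[ℝ] Matrix (Fin n) (Fin n) (mixedSpace K) :=
    { toFun := fun M => M.map (ofComplex K)
      map_add' := map_ofComplex_add
      map_smul' := map_ofComplex_smul }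
  let L : Matrix (Fin n) (Fin n) ℂ →L[ℝ] Matrix (Fin n) (Fin n) (mixedSpace K) :=
    Lₗ.toContinuousLinearMap
  have hL : ∀ M, L M = M.map (ofComplex K) := fun _ => rfl
  set G : Matrix (Fin n) (Fin n) (mixedSpace K) → ℂ := fun M' => F (M'.map (toComplex K)) with hG
  -- `G` agrees with `φ ((M', 1) x)` on invertible `M'`
  have hmapid : ∀ M' : Matrix (Fin n) (Fin n) (mixedSpace K),
      (M'.map (toComplex K)).map (ofComplex K) = M' := fun M' =>
    Matrix.ext fun i j => ofComplex_toComplex K h2 (M' i j)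
  have hG' : ∀ (M' : Matrix (Fin n) (Fin n) (mixedSpace K)) (h : IsUnit M'.det),
      G M' = φ (GLn.ofInfinite n K (Matrix.GeneralLinearGroup.mk'' M' h) * x) := by
    intro M' h
    have hdet : IsUnit (M'.map (toComplex K)).det := by
      rw [← RingHom.mapMatrix_apply, ← RingHom.map_det]; exact h.map _
    -- `ofComplexGL (mk'' (M'.map toComplex)) = ofInfinite (mk'' M')`
    have hGL : ofComplexGL K n (Matrix.GeneralLinearGroup.mk'' (M'.map (toComplex K)) hdet) =
        GLn.ofInfinite n K (Matrix.GeneralLinearGroup.mk'' M' h) := by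
      change GLn.ofInfinite n K (Matrix.GeneralLinearGroup.map (ofComplex K)
        (Matrix.GeneralLinearGroup.mk'' (M'.map (toComplex K)) hdet)) = _
      congr 1
      refine Matrix.GeneralLinearGroup.ext fun i j => ?_
      rw [Matrix.GeneralLinearGroup.map_apply]
      exact ofComplex_toComplex K h2 (M' i j)
    simp only [hG]
    rw [hF _ hdet, hGL]
  have hGs : ContDiffOn ℝ ∞ G {M' : Matrix (Fin n) (Fin n) (mixedSpace K) | IsUnit M'.det} :=
    contDiffOn_of_isArchSmooth hφ x hG'
  -- `F = G ∘ L` and `L` maps invertible matrices to invertible matrices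
  have hFG : ∀ M, F M = G (L M) := fun M => by
    have hLM : (L M).map (toComplex K) = M := Matrix.ext fun i j => toComplex_ofComplex K (M i j)
    simp only [hG, hLM]
  have hmaps : MapsTo L {M : Matrix (Fin n) (Fin n) ℂ | IsUnit M.det}
      {M' : Matrix (Fin n) (Fin n) (mixedSpace K) | IsUnit M'.det} := fun M hM => by
    change IsUnit (L M).det
    rw [hL, ← RingHom.mapMatrix_apply, ← RingHom.map_det]
    exact IsUnit.map _ hM
  have : ContDiffOn ℝ ∞ (fun M => G (L M)) {M : Matrix (Fin n) (Fin n) ℂ | IsUnit M.det} :=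
    hGs.comp L.contDiff.contDiffOn hmaps
  exact this.congr fun M _ => hFG M

end ImaginaryQuadratic

end Literature.NumberTheory.Automorphic

end
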